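import Mathlib
import Literature.Probability.Percolation.Crossings
import Literature.Probability.Percolation.SiteConnectionTools
import Literature.Probability.Percolation.BondPercolationSymmetry
import Literature.Probability.Percolation.LatticeSymmetry
import Literature.Probability.Percolation.InequalitiesProofs
import Literature.Probability.Percolation.MinOpenCut
import Literature.Probability.Percolation.SupercriticalClusterTransienceCorners
import Summits.CriticalPhenomena.PercolationContinuityZ3.Theorems.PinholeClosing.Negative.PinholeClosingBaseline
import HarnessLib

/-!
# Crux `PercBudgetLadder.PinholeClosing` (stmt-CriticalPhenomena-5249), line `halfspace-polarisation` — stub `stub_harrisTiles`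

Helper file for the crux skeleton `Cruxes/PinholeClosing/Lines/halfspace_polarisation.lean`
(lead prover-line-stmt-CriticalPhenomena-5249-0); proves exactly the registered stub `stub_harrisTiles`
(`--supports stmt-CriticalPhenomena-5249`).  No new definitions: statements are in the tree's vocabulary
(`bondPercolation (zdGraph 3) (criticalProbI 3)`, `box`, `innerBoundary`, `openConnIn`).

Informal statement: write `P = bondPercolation (zdGraph 3) (criticalProbI 3)` and, for a tile index
`t = (i, σ, w) ∈ univ ×ˢ ({1, -1} ×ˢ box 3 l)`, let `F_t` be the event that the translated annulus
`z_t + (box 3 L ∖ box 3 n)` (`z_t = Function.update ((2n+1) • w) i (σ a)`) has no open crossing inside its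
front half-box `{v | v - z_t ∈ box 3 L ∧ 0 ≤ σ (v i - z_t i)}`.  If `P(F_t) ≥ c ≥ 0` for every tile, then
`P(⋂ₜ F_t) ≥ c ^ #tiles`.

Proof route: each `F_t` is the complement of an open crossing event, hence DECREASING
(`isUpperSet_openConnIn`, `StubHarrisTiles.isLowerSet_setOf_not_crossing`) and MEASURABLE because the
front half-box is a finite region (`GKZ.measurableSet_openCrossing_of_finite`,
`StubHarrisTiles.measurableSet_setOf_not_crossing`, `StubHarrisTiles.finite_frontHalfBox`).  Harris–FKG for
decreasing events (`harris_fkg_lower`) iterated over the Finset of tiles by `Finset.induction_on`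
(`StubHarrisTiles.pow_card_le_real_biInter`, the template being the `hprod` step of `sqrt_trick_holds`)
gives `P(⋂ₜ F_t) ≥ ∏ₜ P(F_t) ≥ c ^ #tiles`.
-/

noncomputable section

namespace Summit.CriticalPhenomena.PercolationContinuityZ3.Theorems

open MeasureTheory Filter
open Literature.Probability.Percolation Literature.Probability.LatticeModels
open Summit.CriticalPhenomena.PercolationContinuityZ3.Theorems.PinholeClosing.Negative

namespace StubHarrisTiles

/-- **Harris–FKG iterated over a Finset** (Grimmett, *Percolation* (2nd ed., 1999), Thm. (2.4) and
(2.7), p. 34): if `F t`, `t ∈ s`, are decreasing measurable events of Bernoulli bond percolation `P_p` on a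
simple graph `G`, each of probability at least `c ≥ 0`, then `P_p(⋂_{t ∈ s} F t) ≥ c ^ #s`.  Induction on
`s`: the insert step is `c · c ^ #s ≤ P(F a) · P(⋂_s F) ≤ P(F a ∩ ⋂_s F)` by `harris_fkg_lower`. -/
theorem pow_card_le_real_biInter {V ι : Type*} (G : SimpleGraph V) (p : unitInterval) (s : Finset ι)
    (F : ι → Set (BondConfig V)) (c : ℝ) (hc : 0 ≤ c)
    (hlow : ∀ t ∈ s, IsLowerSet (F t)) (hmeas : ∀ t ∈ s, MeasurableSet (F t))
    (hbd : ∀ t ∈ s, c ≤ (bondPercolation G p).real (F t)) :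
    c ^ s.card ≤ (bondPercolation G p).real (⋂ t ∈ s, F t) := by
  classical
  induction s using Finset.induction_on with
  | empty => simp
  | insert a s ha ih =>
    have hlow' : ∀ t ∈ s, IsLowerSet (F t) := fun t ht => hlow t (Finset.mem_insert_of_mem ht)
    have hmeas' : ∀ t ∈ s, MeasurableSet (F t) := fun t ht => hmeas t (Finset.mem_insert_of_mem ht)
    have hbd' : ∀ t ∈ s, c ≤ (bondPercolation G p).real (F t) := fun t ht =>
      hbd t (Finset.mem_insert_of_mem ht)
    rw [Finset.card_insert_of_notMem ha, Finset.set_biInter_insert, pow_succ']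
    calc c * c ^ s.card
        ≤ (bondPercolation G p).real (F a) * (bondPercolation G p).real (⋂ t ∈ s, F t) :=
          mul_le_mul (hbd a (Finset.mem_insert_self a s)) (ih hlow' hmeas' hbd') (pow_nonneg hc _)
            measureReal_nonneg
      _ ≤ (bondPercolation G p).real (F a ∩ ⋂ t ∈ s, F t) :=
          harris_fkg_lower G p (hlow a (Finset.mem_insert_self a s)) (isLowerSet_iInter₂ hlow')
            (hmeas a (Finset.mem_insert_self a s)) (s.measurableSet_biInter hmeas')

/-- The absence of an open crossing from `A` to `B` inside `S` is a decreasing event: it is the complement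
of the increasing event `openCrossing S A B` (Grimmett 1999, §2.1; `isUpperSet_openConnIn`). -/
theorem isLowerSet_setOf_not_crossing {V : Type*} (S : Set V) (A B : Finset V) :
    IsLowerSet {ω : BondConfig V | ¬ ∃ x ∈ A, ∃ y ∈ B, ω ∈ openConnIn S x y} :=
  fun _ _ hle hω ⟨x, hx, y, hy, hω'⟩ => hω ⟨x, hx, y, hy, isUpperSet_openConnIn S x y hle hω'⟩

/-- The absence of an open crossing from `A` to `B` inside a FINITE region `S ⊆ ℤ³` is a measurable event
(a cylinder event of the edges meeting `S`; complement of `GKZ.measurableSet_openCrossing_of_finite`). -/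
theorem measurableSet_setOf_not_crossing {S : Set (Site 3)} (hS : S.Finite) (A B : Finset (Site 3)) :
    MeasurableSet {ω : BondConfig (Site 3) | ¬ ∃ x ∈ A, ∃ y ∈ B, ω ∈ openConnIn S x y} := by
  have h : {ω : BondConfig (Site 3) | ¬ ∃ x ∈ A, ∃ y ∈ B, ω ∈ openConnIn S x y} =
      (openCrossing S ↑A ↑B)ᶜ := Set.ext fun _ => Iff.rfl
  rw [h]
  exact (GKZ.measurableSet_openCrossing_of_finite hS _ _).compl

/-- The front half-box `{v | v - z ∈ box 3 L ∧ 0 ≤ σ (v i - z i)}` of the translated box `z + box 3 L` is a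
finite region (it is contained in the translate `(· + z) '' box 3 L`). -/
theorem finite_frontHalfBox (z : Site 3) (i : Fin 3) (σ : ℤ) (L : ℕ) :
    {v : Site 3 | v - z ∈ box 3 L ∧ 0 ≤ σ * (v i - z i)}.Finite := by
  refine ((box 3 L).finite_toSet.image (· + z)).subset ?_
  rintro v ⟨hv, -⟩
  exact ⟨v - z, hv, sub_add_cancel v z⟩

end StubHarrisTiles

/-- **Harris over the tiles** (step of `blocked_of_halfspaceShare`, line `halfspace-polarisation`).
With `P = bondPercolation (zdGraph 3) (criticalProbI 3)` and, for `t = (i, σ, w) ∈ univ ×ˢ ({1, -1} ×ˢ box 3 l)`,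
`z_t = Function.update ((2n+1) • w) i (σ a)` and `F_t` the event "no open crossing from `z_t + box 3 n` to
`z_t + ∂ⁱⁿ box 3 L` inside the front half-box `{v | v - z_t ∈ box 3 L ∧ 0 ≤ σ (v i - z_t i)}`": if `0 ≤ c`
and `c ≤ P(F_t)` for every tile `t`, then `c ^ #tiles ≤ P(⋂ₜ F_t)`.  Proof: every `F_t` is decreasing
(`StubHarrisTiles.isLowerSet_setOf_not_crossing`) and measurable (finite region,
`StubHarrisTiles.measurableSet_setOf_not_crossing`), so Harris–FKG iterated over the Finset of tiles
(`StubHarrisTiles.pow_card_le_real_biInter`, from `harris_fkg_lower`) applies. -/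
theorem stub_harrisTiles :
    ∀ (n l a L : ℕ) (c : ℝ), 0 ≤ c →
      (∀ t ∈ (Finset.univ : Finset (Fin 3)) ×ˢ (({1, -1} : Finset ℤ) ×ˢ box 3 l), c ≤ (bondPercolation (zdGraph 3) (criticalProbI 3)).real
        {ω : BondConfig (Site 3) | ¬ ∃ x ∈ (box 3 n).image (· + (Function.update ((2 * (n : ℤ) + 1) • t.2.2) t.1 (t.2.1 * (a : ℤ)))), ∃ y ∈ (innerBoundary (zdGraph 3) (box 3 L)).image (· + (Function.update ((2 * (n : ℤ) + 1) • t.2.2) t.1 (t.2.1 * (a : ℤ)))), ω ∈ openConnIn {v : Site 3 | v - (Function.update ((2 * (n : ℤ) + 1) • t.2.2) t.1 (t.2.1 * (a : ℤ))) ∈ box 3 L ∧ 0 ≤ t.2.1 * (v t.1 - (Function.update ((2 * (n : ℤ) + 1) • t.2.2) t.1 (t.2.1 * (a : ℤ))) t.1)} x y}) →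
      c ^ ((Finset.univ : Finset (Fin 3)) ×ˢ (({1, -1} : Finset ℤ) ×ˢ box 3 l)).card ≤ (bondPercolation (zdGraph 3) (criticalProbI 3)).real
        (⋂ t ∈ (Finset.univ : Finset (Fin 3)) ×ˢ (({1, -1} : Finset ℤ) ×ˢ box 3 l),
          {ω : BondConfig (Site 3) | ¬ ∃ x ∈ (box 3 n).image (· + (Function.update ((2 * (n : ℤ) + 1) • t.2.2) t.1 (t.2.1 * (a : ℤ)))), ∃ y ∈ (innerBoundary (zdGraph 3) (box 3 L)).image (· + (Function.update ((2 * (n : ℤ) + 1) • t.2.2) t.1 (t.2.1 * (a : ℤ)))), ω ∈ openConnIn {v : Site 3 | v - (Function.update ((2 * (n : ℤ) + 1) • t.2.2) t.1 (t.2.1 * (a : ℤ))) ∈ box 3 L ∧ 0 ≤ t.2.1 * (v t.1 - (Function.update ((2 * (n : ℤ) + 1) • t.2.2) t.1 (t.2.1 * (a : ℤ))) t.1)} x y}) := by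
  intro n l a L c hc hbd
  exact StubHarrisTiles.pow_card_le_real_biInter (zdGraph 3) (criticalProbI 3) _ _ c hc
    (fun t _ => StubHarrisTiles.isLowerSet_setOf_not_crossing _ _ _)
    (fun t _ => StubHarrisTiles.measurableSet_setOf_not_crossing
      (StubHarrisTiles.finite_frontHalfBox _ _ _ _) _ _)
    hbd

end Summit.CriticalPhenomena.PercolationContinuityZ3.Theorems

end
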